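import Literature.AnabelianGeometry.AbsoluteAnabelian.AbsTopII.EllipticCuspidalizationComparison
import Literature.AnabelianGeometry.AbsoluteAnabelian.SubpadicSlimProofs
import Literature.AnabelianGeometry.AbsoluteAnabelian.SubpadicExamples
import Literature.AnabelianGeometry.AbsoluteAnabelian.AbsTopIII.KummerFaithfulSubpadicProofs
import Literature.AnabelianGeometry.AbsoluteAnabelian.SlimTransport
import Literature.AnabelianGeometry.SemiGraphs.WitnessIwahoriGroup
import HarnessLib

/-!
# [AbsTopII] Cor 3.3 (i), (iii), Cor 3.4 over a class `𝒟`: INSTANCE FORMS of the schemata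
# `EllipticModel.RealizesCore` (F-0294), `EllipticModel.Cor_3_3_i` (F-0289), `EllipticModel.Matches`
# (F-0293), `EllipticModel.Cor_3_3_iii` (F-0291), `EllipticModel.Cor_3_4` (F-0292) — kernel proofs

S. Mochizuki, *Topics in Absolute Anabelian Geometry II: Decomposition Groups and Endomorphisms*
[AbsTopII] (bib `MochizukiAbsTopII2013`; kurims manuscript `paper:url-585b8d0ad0d9`), §3: Corollary 3.3
(i) pp. 67–68 ("the finite étale covering `X_{k'} → C` determines a chain `X_{k'} ⇝ C` [...] whose image
`Π' ⇝ Π_C` in `Chain(Π')` may be characterized 'group-theoretically', up to isomorphism in `Chain(Π')`, as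
the unique chain of length `1` in `Chain(Π')`, with associated type-chain `⋎`, such that the resulting
object of `ÉtLoc(Π')` forms a terminal object of `ÉtLoc(Π')`"), Corollary 3.3 (iii) pp. 68–69 ("for any
`G' ⊆ G` that is sufficiently small, where 'sufficiently' depends only on `N`, the natural surjection
`Π_{U_X} ↠ Π` [...] may be constructed via 'group-theoretic' operations"), Corollary 3.4 pp. 69–70 ("there
exists an isomorphism of profinite groups `φ_U : Π_{U_{X₁}} ⥲ Π_{U_{X₂}}` that is compatible with `φ`
[...]. Moreover, such an isomorphism is unique up to composition with an inner automorphism arising from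
an element of the kernel of `Π_{U_{Xᵢ}} ↠ Πᵢ`"); Def 3.1 (a) p. 65 ("`X` admits a `k`-core `X → C`").

PROOF-ONLY companion (cell abc-iut, block F, seat abc-iut-f-033 gen 7, KEY row «INST59B»; no `def`, no
instance, no notation, no new named fact) of abc-iut-L4-t6's `EllipticCuspidalizationComparison.lean`
(imported, never edited).  CONTEXT.  The five FACT-LIST rows are SCHEMATA over the MODEL INTERFACE
`EllipticModel 𝒟` (free model data `coreExt / toCore / Setting / cuspUX`, no instance in the tree); their
universal closures over `(𝒟, M)` are REFUTED in the tree (abc-iut-f-067 `EllipticModel.not_forall_cor_3_3_i`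
/ `not_forall_cor_3_3_iii`, abc-iut-f-068 `not_forall_cor_3_4` / `not_forall_matches` /
`not_forall_realizesCore`) and the rows are consumed BY NAME at instances (rule R5).  This file adds
theorems whose conclusion HEAD is the row's declaration, at the NATURAL SUB-INSTANCES the refuters'
counter-models spare:

* F-0294 `realizesCore_selfQuot_of_bijective` — **the member that IS its own `k`-core** (Def 3.1 (a) with
  `C = X`, i.e. `Π ↪ Π_C` bijective; e.g. `X` semi-elliptic): the length-`1` chain `Π ⇝ Π` of type `⋎`
  (the identity open immersion, abc-iut-L4-t6's `isElemOp_finEtQuot_self`) REALIZES the core — PROVED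
  (the refuter's witness was the length-`0` chain, type-chain `[] ≠ [⋎]`).
* F-0289 `cor_3_3_i_of_selfCore` — **Cor 3.3 (i) at self-core models**: when every Cor-3.3 member is its
  own `k`-core, the row REDUCES to print's group-theoretic content at `Π` itself — "`Π` (the trivial chain)
  is a terminal object of `ÉtLoc(Π)` among pro-`Σ` chains" (`IsEtLocTerminalFor`, = "`X` is a `k`-core",
  [Mzk6] Rmk 2.1.1 via Def 3.1 (a)) plus the uniqueness clause — displayed as hypotheses `hterm`, `huniq`
  on the tree's NAMED `trivialChain`; the existence half is the F-0294 instance.  CONDITIONAL instance (the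
  refuter's `Π = Iw₂ × G_{ℚ₂}` is not `ÉtLoc`-terminal: it fails `huniq`'s consequence "co-Hopfian").
* F-0293 `Matches.of_iso` (+ `Cuspidalization.IsoOver.trans`) — **`Matches` is invariant under isomorphism
  of outputs** (same `N`, `Σ`, `Π_V`, cusp images; cores isomorphic under `Π`; `Π_{U_X} ↠ Π` isomorphic
  over `Π`): print's output is an isomorphism class ("up to isomorphism"), and the typed predicate respects
  it.  CONDITIONAL instance (transport).
* F-0291 `cor_3_3_iii_of_forall_setting` — **the UNIFORM instance**: if every setting of every Cor-3.3
  member admits a matching output with the chain clause, the row holds with `G₀ := G` ("sufficiently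
  small" = no constraint); `cor_3_3_iii_of_isEmpty_setting` — the DEGENERATE instance with no settings
  (abc-iut-f-068's consistency model `M₂`).
* F-0292 `cor_3_4_of_cuspUX_bijective` — **Cor 3.4 at models all of whose cuspidalizations `Π_{U_X} ↠ Π`
  are bijective** (`U_X = X`: the `N`-torsion removed from `D = E ∖ {O}` adds no cusp to `X`, the `N = 1`
  reading; abc-iut-f-068's consistency model has `Π_{U_X} ↠ Π := id`): `φ_U := (Π_{U_{X₂}} ⥲ Π₂)⁻¹ ∘ φ ∘
  (Π_{U_{X₁}} ⥲ Π₁)`, unique on the nose (`g := 1`) — PROVED; the refuter's second setting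
  (`ℤ/2 × Π ↠ Π`, not injective) is exactly what this instance excludes.

NON-VACUITY (`exists_selfCore_model_instances_fire`, the model of abc-iut-f-068's
`EllipticModel.exists_models_cor_3_4_and_cor_3_3_ii` rebuilt verbatim): over the genuine field `ℚ_p` a
chain-full rel-isom-DGC class with a Cor-3.3 member (`G_{ℚ_p}` slim, `χ_p` open — tree theorems;
`Δ = ℤ_p ⋊ (1 + pℤ_p)` slim nontrivial), `toCore := 𝟙`, one setting, `Π_{U_X} ↠ Π := 𝟙`: the hypotheses
`hbij` (F-0289/F-0294) and `hU` (F-0292) hold there and the two PROVED instance forms fire — `M.Cor_3_4`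
holds and the chain `Π ⇝ Π` realizes the core of a member satisfying the standing hypotheses.

HONEST FRAMING: instance forms are statements about OUR typing of the interface; the self-core /
bijective-cuspidalization sub-instances are the trivial corner of print's situation (`X = C`, `U_X = X`),
where the anabelian content (`ÉtLoc`-terminality of `Π`) stays a displayed hypothesis; conditional ≠
proved; typed ≠ proved; refuted-as-typed ≠ refuted-in-print; nothing here bears on [IUTchIII] Cor 3.12 or
asserts that abc is proved or refuted.  Axioms standard.
-/

noncomputable section

open CategoryTheory Topology

universe u

namespace Literature.AnabelianGeometry.AbsoluteAnabelian.AbsTopII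

open Literature.AlgebraicGeometry.Frobenioids (IsSlimGroup)
open Literature.AnabelianGeometry.SemiGraphs (Iw)
open FundamentalExtension AugmentedProfiniteGrp
open AbsTopI (ConstructionDataClass)

/-! ### `IsoOver` is transitive (used for F-0293) -/

/-- Isomorphy of cuspidalizations over `Π` is transitive (compose the isomorphisms of the `Π_U`'s).
[cite: MochizukiAbsTopII2013, Cor 3.8 p.74] -/
theorem Cuspidalization.IsoOver.trans {E : FundamentalExtension.{u}} {c c' c'' : Cuspidalization E}
    (h : c.IsoOver c') (h' : c'.IsoOver c'') : c.IsoOver c'' := by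
  obtain ⟨β, hβ⟩ := h
  obtain ⟨β', hβ'⟩ := h'
  refine ⟨β.trans β', fun x => ?_⟩
  change c''.hom.arith (β' (β x)) = c.hom.arith x
  rw [hβ' (β x), hβ x]

namespace EllipticModel

variable {𝒟 : ConstructionDataClass.{u}} {M : EllipticModel 𝒟}

/-! ### F-0294: the self-core instance of `RealizesCore` -/

/-- **F-0294, INSTANCE FORM (PROVED): the member that is its own `k`-core.**  If `Π ↪ Π_C` (the model's
`toCore`, an open injection over `G`) is BIJECTIVE — Def 3.1 (a) with `C = X` — then the length-`1`
`Π`-chain `Π ⇝ Π` of type `⋎` (identity open immersion, rigidified by the identity) realizes the `k`-core: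
its last group `Π` is isomorphic to `Π_C` by `toCore` itself (a continuous bijection of profinite groups),
compatibly with the projections to `G` (`toCore.comm`) and with `Π ⊆ Π_C` on the rigidification domain.
[cite: MochizukiAbsTopII2013, Cor 3.3 (i) p.67] -/
theorem realizesCore_selfQuot_of_bijective {b : 𝒟.Base} {X : (𝒟.datum b).Obj}
    (hP : IsSlimGroup ((𝒟.datum b).ext X).arith) (hΔ : IsSlimGroup ((𝒟.datum b).ext X).geom)
    (hne : ((𝒟.datum b).ext X).geom ≠ ⊥) (hbij : Function.Bijective (M.toCore b X).arith) :
    M.RealizesCore b X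
      ({ len := 1
         term := fun _ => ChainGroup.self hP hΔ hne
         term_zero := rfl
         types := fun _ => ElemOpType.finEtQuot
         isElemOp := fun _ => isElemOp_finEtQuot_self } :
        ((𝒟.datum b).ext X).PiChain (M.cusps b X) hP hΔ hne) := by
  -- `toCore` as an isomorphism of topological groups (compact source, Hausdorff target)
  let f : ((𝒟.datum b).ext X).arith →ₜ* (M.coreExt b X).arith := (M.toCore b X).arith
  let e : ((𝒟.datum b).ext X).arith ≃ₜ* (M.coreExt b X).arith :=
    { toMulEquiv := MulEquiv.ofBijective f hbij
      continuous_toFun := f.continuous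
      continuous_invFun :=
        (Continuous.homeoOfEquivCompactToT2 (f := Equiv.ofBijective f hbij) f.continuous).symm.continuous }
  refine ⟨rfl, e, fun y => ?_, fun x => ?_⟩
  · exact (M.toCore b X).comm y
  · rfl

/-! ### F-0289: `Cor_3_3_i` at self-core models -/

/-- **F-0289, CONDITIONAL INSTANCE FORM: Cor 3.3 (i) at SELF-CORE models.**  Suppose every Cor-3.3 member
`X` of `M` is its own `k`-core (`hbij`: `Π ↪ Π_C` bijective), with `Δ` pro-`Σ` (`hSig`, condition (3_Π) for
the chain `Π ⇝ Π`).  Then `M.Cor_3_3_i` REDUCES to print's group-theoretic content AT `Π` ITSELF,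
displayed as hypotheses on the tree's named `trivialChain` (whose last group is `Π ↠ G`, the same as that
of `Π ⇝ Π`): `hterm` — "`Π` forms a terminal object of `ÉtLoc(Π)`" among pro-`Σ` chains
(`IsEtLocTerminalFor`; = "`X` is a `k`-core" read group-theoretically, [Mzk6] Rmk 2.1.1 via Def 3.1 (a)),
and `huniq` — every pro-`Σ` `⋎`-chain of length `1` that is `ÉtLoc`-terminal is isomorphic in `Chain(Π)`
to it.  The realizing chain is `Π ⇝ Π` (`realizesCore_selfQuot_of_bijective`).
[cite: MochizukiAbsTopII2013, Cor 3.3 (i) pp.67-68] -/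
theorem cor_3_3_i_of_selfCore
    (hbij : ∀ (b : 𝒟.Base) (X : (𝒟.datum b).Obj), M.IsCor33Member b X →
      Function.Bijective (M.toCore b X).arith)
    (hSig : ∀ (b : 𝒟.Base) (X : (𝒟.datum b).Obj), M.IsCor33Member b X →
      IsProSet ((𝒟.datum b).ext X).geom (𝒟.datum b).primes)
    (hterm : ∀ (b : 𝒟.Base) (X : (𝒟.datum b).Obj) (h : M.IsCor33Member b X),
      IsEtLocTerminalFor (𝒟.datum b).primes
        (trivialChain (M.cusps b X) h.arith_slim h.geom_slim h.geom_ne_bot))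
    (huniq : ∀ (b : 𝒟.Base) (X : (𝒟.datum b).Obj) (h : M.IsCor33Member b X)
      (c' : ((𝒟.datum b).ext X).PiChain (M.cusps b X) h.arith_slim h.geom_slim h.geom_ne_bot),
      IsProSigmaChain (𝒟.datum b).primes c' → c'.typeChain = [ElemOpType.finEtQuot] →
        IsEtLocTerminalFor (𝒟.datum b).primes c' →
          LastTermsIsomorphic c' (trivialChain (M.cusps b X) h.arith_slim h.geom_slim h.geom_ne_bot)) :
    M.Cor_3_3_i := by
  intro _ _ b X h
  refine ⟨{ len := 1
            term := fun _ => ChainGroup.self h.arith_slim h.geom_slim h.geom_ne_bot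
            term_zero := rfl
            types := fun _ => ElemOpType.finEtQuot
            isElemOp := fun _ => isElemOp_finEtQuot_self },
    fun _ => hSig b X h, realizesCore_selfQuot_of_bijective _ _ _ (hbij b X h), ?_, ?_⟩
  · exact hterm b X h
  · intro c' hσ hτ ht
    exact huniq b X h c' hσ hτ ht

/-! ### F-0293: `Matches` is invariant under isomorphism of outputs -/

/-- **F-0293, CONDITIONAL INSTANCE FORM (transport): an output isomorphic to a matching output matches.**
If `C` matches the setting `s` and `C'` has the same `N`, `Σ`, `Π_V` and cusp-image set, a core
isomorphic to `C.core` under `Π` carrying `C'.PiD` to `C.PiD`, and an output `Π_{U_X} ↠ Π` isomorphic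
over `Π` to that of `C`, then `C'` matches `s` — print's output of Cor 3.3 (iii) is an isomorphism class
("up to isomorphism", "compatible [...] relative to the natural surjections").
[cite: MochizukiAbsTopII2013, Cor 3.3 (iii) p.68] -/
theorem Matches.of_iso {b : 𝒟.Base} {X : (𝒟.datum b).Obj} {s : M.Setting b X}
    {C C' : EllipticCuspidalization ((𝒟.datum b).ext X)} (h : M.Matches s C) (hN : C'.N = C.N)
    (hSig : C'.Sigma = C.Sigma) (e : C'.core ≅ C.core) (he : C'.toCore ≫ e.hom = C.toCore)
    (hD : C'.PiD.map e.hom.arith.toMonoidHom = C.PiD) (hV : C'.PiV = C.PiV)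
    (hU : C'.toCuspidalization.IsoOver C.toCuspidalization)
    (hc : C'.toCuspidalization.decompositionImages C'.cusps =
      C.toCuspidalization.decompositionImages C.cusps) :
    M.Matches s C' := by
  obtain ⟨hN₀, hSig₀, ⟨e₀, he₀, hD₀⟩, hV₀, hU₀, hc₀⟩ := h
  refine ⟨hN.trans hN₀, hSig.trans hSig₀, ⟨e ≪≫ e₀, ?_, ?_⟩, hV.trans hV₀, hU.trans hU₀, hc.trans hc₀⟩
  · rw [Iso.trans_hom, ← Category.assoc, he, he₀]
  · rw [← hD₀, ← hD, Subgroup.map_map, Iso.trans_hom]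
    rfl

/-! ### F-0291: the uniform instance of `Cor_3_3_iii` (and the degenerate one) -/

/-- **F-0291, CONDITIONAL INSTANCE FORM: the UNIFORM instance of Cor 3.3 (iii).**  If EVERY setting of
every Cor-3.3 member admits an output matching it whose type-chain / `Π_V` are those of a pro-`Σ` chain
with a terminal isomorphism to the trivial chain, then `M.Cor_3_3_iii` holds — with `G₀ := G` ("for any
`G' ⊆ G` that is sufficiently small, where 'sufficiently' depends only on `N`": here no shrinking is
needed). [cite: MochizukiAbsTopII2013, Cor 3.3 (iii) pp.68-69] -/
theorem cor_3_3_iii_of_forall_setting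
    (h : ∀ (b : 𝒟.Base) (X : (𝒟.datum b).Obj) (hX : M.IsCor33Member b X) (s : M.Setting b X),
      ∃ C : EllipticCuspidalization ((𝒟.datum b).ext X), M.Matches s C ∧
        HasProSigmaTerminalChainOfType (𝒟.datum b).primes (M.cusps b X) hX.arith_slim
          hX.geom_slim hX.geom_ne_bot C.typeChain C.PiV) :
    M.Cor_3_3_iii := by
  intro _ _ b X hX N
  refine ⟨⊤, ?_, fun s _ _ => h b X hX s⟩
  rw [Subgroup.coe_top]
  exact isOpen_univ

/-- **F-0291, DEGENERATE INSTANCE FORM: no settings.**  At a model none of whose members carries a setting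
`(D → C, G', N, U, V, U_X)` (abc-iut-f-068's consistency model `M₂` of `EllipticComparisonConsistency`),
`M.Cor_3_3_iii` holds vacuously in the settings.  Honest label: degenerate.
[cite: MochizukiAbsTopII2013, Cor 3.3 (iii) pp.68-69] -/
theorem cor_3_3_iii_of_isEmpty_setting
    (h : ∀ (b : 𝒟.Base) (X : (𝒟.datum b).Obj), IsEmpty (M.Setting b X)) : M.Cor_3_3_iii :=
  cor_3_3_iii_of_forall_setting fun b X _ s => (h b X).elim s

/-! ### F-0292: `Cor_3_4` at models with bijective cuspidalizations -/

/-- **F-0292, INSTANCE FORM (PROVED): Cor 3.4 when every "natural surjection `Π_{U_X} ↠ Π`" is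
BIJECTIVE** (`U_X = X`: no closed point of `X` is removed).  Then for members `X₁, X₂`, settings `s₁, s₂`
and `φ : Π₁ ⥲ Π₂` as in Cor 3.4, `φ_U := (Π_{U_{X₂}} ⥲ Π₂)⁻¹ ∘ φ ∘ (Π_{U_{X₁}} ⥲ Π₁)` is an
isomorphism compatible with `φ` relative to the surjections, and any two such agree on the nose (the
kernel of `Π_{U_{X₂}} ↠ Π₂` is trivial; `g := 1`).  The other hypotheses of Cor 3.4 (`𝒟` chain-full,
rel-isom-DGC, standing hypotheses, common `N` and `l`) are not used at this instance.
[cite: MochizukiAbsTopII2013, Cor 3.4 pp.69-70] -/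
theorem cor_3_4_of_cuspUX_bijective
    (hU : ∀ (b : 𝒟.Base) (X : (𝒟.datum b).Obj) (s : M.Setting b X),
      Function.Bijective (M.cuspUX s).hom.arith) :
    M.Cor_3_4 := by
  intro _ _ b₁ b₂ X₁ X₂ _ _ s₁ s₂ _ _ _ φ _
  -- `Π_{U_X} ⥲ Π` as an isomorphism of topological groups, for every setting
  have mk : ∀ {b : 𝒟.Base} {X : (𝒟.datum b).Obj} (s : M.Setting b X),
      ∃ e : (M.cuspUX s).ext.arith ≃ₜ* ((𝒟.datum b).ext X).arith,
        ∀ x, e x = (M.cuspUX s).hom.arith x := by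
    intro b X s
    let f : (M.cuspUX s).ext.arith →ₜ* ((𝒟.datum b).ext X).arith := (M.cuspUX s).hom.arith
    exact
      ⟨{ toMulEquiv := MulEquiv.ofBijective f (hU b X s)
         continuous_toFun := f.continuous
         continuous_invFun :=
           (Continuous.homeoOfEquivCompactToT2 (f := Equiv.ofBijective f (hU b X s))
             f.continuous).symm.continuous }, fun _ => rfl⟩
  obtain ⟨e₁, he₁⟩ := mk s₁
  obtain ⟨e₂, he₂⟩ := mk s₂
  refine ⟨⟨e₁.trans (φ.trans e₂.symm), fun x => ?_⟩, fun φU φU' hφU hφU' => ⟨1, map_one _, fun x => ?_⟩⟩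
  · change (M.cuspUX s₂).hom.arith (e₂.symm (φ (e₁ x))) = φ ((M.cuspUX s₁).hom.arith x)
    rw [← he₂, ContinuousMulEquiv.apply_symm_apply, he₁]
  · rw [one_mul, inv_one, mul_one]
    exact (hU b₂ X₂ s₂).1 ((hφU' x).trans (hφU x).symm)

/-! ### Non-vacuity: the proved instance forms fire at a kernel model with inhabited hypotheses -/

/-- **NON-VACUITY of the F-0292 / F-0294 instances** (model of abc-iut-f-068's
`exists_models_cor_3_4_and_cor_3_3_ii`, rebuilt): for every prime `p` there are a class `𝒟` (one field,
the genuine `ℚ_p`; `Σ` = all primes; scheme isomorphisms := outer isomorphisms; no chain terms), a model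
`M`, a member `X` with `Π = (ℤ_p ⋊ (1 + pℤ_p)) × G_{ℚ_p}` and a setting `s` such that `𝒟` is chain-full,
the rel-isom-DGC holds, `X` satisfies the standing hypotheses of Cor 3.3 / 3.4 (`G_{ℚ_p}` slim, `χ_p` open,
`Δ` slim nontrivial — tree theorems), every `Π ↪ Π_C` and every `Π_{U_X} ↠ Π` is bijective, and hence
(`cor_3_4_of_cuspUX_bijective`, `realizesCore_selfQuot_of_bijective`) `M.Cor_3_4` holds and the chain
`Π ⇝ Π` realizes the `k`-core of `X`.  Junk model data over a genuine field; not a curve.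
[cite: MochizukiAbsTopII2013, Cor 3.4 pp.69-70] -/
theorem exists_selfCore_model_instances_fire (p : ℕ) [Fact p.Prime] :
    ∃ (𝒟 : ConstructionDataClass.{0}) (M : EllipticModel 𝒟) (b : 𝒟.Base) (X : (𝒟.datum b).Obj)
      (h : M.IsCor33Member b X) (_ : M.Setting b X),
      𝒟.IsChainFull ∧ 𝒟.RelIsomDGC ∧
        (∀ (b : 𝒟.Base) (X : (𝒟.datum b).Obj), Function.Bijective (M.toCore b X).arith) ∧
        (∀ (b : 𝒟.Base) (X : (𝒟.datum b).Obj) (s : M.Setting b X),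
          Function.Bijective (M.cuspUX s).hom.arith) ∧
        M.Cor_3_4 ∧
        M.RealizesCore b X
          ({ len := 1
             term := fun _ => ChainGroup.self h.arith_slim h.geom_slim h.geom_ne_bot
             term_zero := rfl
             types := fun _ => ElemOpType.finEtQuot
             isElemOp := fun _ => isElemOp_finEtQuot_self } :
            ((𝒟.datum b).ext X).PiChain (M.cusps b X) h.arith_slim h.geom_slim h.geom_ne_bot) := by
  -- adapted from abc-iut-f-068's `EllipticComparisonConsistency.lean` (model rebuilt verbatim)
  -- the genuine base field `ℚ_p`: `G = G_{ℚ_p}` is slim and `χ_p` has open image (tree theorems)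
  let G : ProfiniteGrp.{0} := absoluteGaloisGrp ℚ_[p]
  have hG : IsSlimGroup G :=
    IsSubpadicFor.isSlimGroup_absoluteGaloisGroup (AbsTopIII.IsSubpadicFor.padic p)
  have hsub : AbsTopIII.IsSubpadic ℚ_[p] := ⟨⟨p, inferInstance, AbsTopIII.IsSubpadicFor.padic p⟩⟩
  have hχ : IsOpen (Set.range (AbsTopIII.cyclotomicChar ℚ_[p] p)) :=
    hsub.isOpen_range_cyclotomicChar p
  -- `Δ := P = ℤ_p ⋊ (1 + pℤ_p)` (slim, nontrivial), `Π := P × G ↠ G`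
  let P : Type := Iw p
  have hPslim : IsSlimGroup P := ⟨Literature.AnabelianGeometry.SemiGraphs.Iw.centralizer_eq_bot_of_isOpen⟩
  let A : AugmentedProfiniteGrp G :=
    { arith := ProfiniteGrp.of (P × G)
      aug := ContinuousMonoidHom.snd P G
      aug_surjective := fun g => ⟨(1, g), rfl⟩ }
  -- the datum, the class, the (empty) cuspidal data, the model
  let D : RelativeAnabelianDatum G :=
    { Obj := PUnit.{1}, Hom := fun _ _ => A.OuterHom A, IsIso := fun c => c.IsIso,
      IsHyperbolicCurve := fun _ => True, primes := Set.univ, grp := fun _ => A,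
      outerHom := fun c => c }
  let 𝒟 : ConstructionDataClass.{0} :=
    { Base := PUnit.{1}, fld := fun _ => ℚ_[p], instField := fun _ => inferInstance,
      instCharZero := fun _ => inferInstance, datum := fun _ => D, Mem := fun _ _ => True,
      IsHyperbolicOrbicurve := fun _ _ => True,
      isHyperbolicOrbicurve_of_isHyperbolicCurve := fun _ _ _ => trivial,
      chainTerms := fun _ _ => ∅ }
  let noCusps : ∀ E' : FundamentalExtension.{0}, CuspidalData E' := fun E' =>
    { Cusp := PEmpty.{1}, Dcusp := fun x => x.elim, Icusp := fun x => x.elim,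
      Icusp_eq := fun x => x.elim, isClosed_Dcusp := fun x => x.elim,
      eq_of_conj := fun x => x.elim }
  let M : EllipticModel 𝒟 :=
    { cusps := fun _ _ => noCusps _
      IsEllipticallyAdmissible := fun _ _ => True
      coreExt := fun b X => (𝒟.datum b).ext X
      toCore := fun _ _ => 𝟙 _
      toCore_isOpenInjective := fun _ _ => Hom.IsOpenInjective.id _
      toCore_gal_bijective := fun _ _ => Function.bijective_id
      doubleCovers := fun _ _ => Set.univ
      Setting := fun _ _ => PUnit.{1}
      PiD := fun _ => ⊤, PiD_mem := fun _ => Set.mem_univ _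
      galOpen := fun _ => ⊤, normal_galOpen := fun _ => inferInstance
      isOpen_galOpen := fun _ => isOpen_univ
      level := fun _ => 1
      level_isSigmaInteger := fun _ => ⟨Nat.one_pos, fun q _ _ => Set.mem_univ q⟩
      PiV := fun _ => ⊤, normal_PiV := fun _ => inferInstance, isOpen_PiV := fun _ => isOpen_univ
      PiV_le := fun _ _ _ => Subgroup.mem_comap.mpr (Subgroup.mem_top _)
      map_PiV_le := fun _ => le_top
      cuspUX := fun _ => ⟨_, 𝟙 _, Function.surjective_id, Function.bijective_id⟩
      proSet_geom_cuspUX := fun _ => ⟨fun _ _ _ q _ _ => Set.mem_univ q⟩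
      cuspsUX := fun _ => noCusps _ }
  -- `Δ = P × 1` is slim (transport from `P`) and nontrivial
  have hΔ : IsSlimGroup ((𝒟.datum PUnit.unit).ext PUnit.unit).geom := by
    refine isSlimGroup_of_continuousMulEquiv (G := P) ?_ hPslim
    exact
      { toFun := fun x => ⟨(x, 1), rfl⟩
        invFun := fun y => y.1.1
        left_inv := fun _ => rfl
        right_inv := fun y => Subtype.ext (Prod.ext rfl y.2.symm)
        map_mul' := fun _ _ => Subtype.ext (Prod.ext rfl (one_mul 1).symm)
        continuous_toFun := (continuous_id.prodMk continuous_const).subtype_mk _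
        continuous_invFun := continuous_fst.comp continuous_subtype_val }
  have hne : ((𝒟.datum PUnit.unit).ext PUnit.unit).geom ≠ ⊥ := by
    intro h
    let x : ((𝒟.datum PUnit.unit).ext PUnit.unit).arith := ((⟨1, 0⟩ : Iw p), (1 : G))
    have hx : x ∈ ((𝒟.datum PUnit.unit).ext PUnit.unit).geom := rfl
    have hx1 : x = 1 := (Subgroup.eq_bot_iff_forall _).mp h x hx
    have ha := congrArg (fun y : ((𝒟.datum PUnit.unit).ext PUnit.unit).arith => (y.1 : Iw p).a) hx1
    change (1 : ℤ_[p]) = 0 at ha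
    exact one_ne_zero ha
  have hmem : M.IsCor33Member PUnit.unit PUnit.unit :=
    { mem := trivial, ellipticallyAdmissible := trivial, slim := hG,
      cyclotomic := ⟨p, inferInstance, Set.mem_univ p, hχ⟩, geom_slim := hΔ, geom_ne_bot := hne }
  have hbij : ∀ (b : 𝒟.Base) (X : (𝒟.datum b).Obj), Function.Bijective (M.toCore b X).arith :=
    fun _ _ => Function.bijective_id
  have hU : ∀ (b : 𝒟.Base) (X : (𝒟.datum b).Obj) (s : M.Setting b X),
      Function.Bijective (M.cuspUX s).hom.arith :=
    fun _ _ _ => Function.bijective_id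
  exact ⟨𝒟, M, PUnit.unit, PUnit.unit, hmem, PUnit.unit,
    fun _ _ _ t ht => ((Set.mem_empty_iff_false t).mp ht).elim, fun _ _ _ _ _ => Set.bijOn_id _,
    hbij, hU, cor_3_4_of_cuspUX_bijective hU,
    realizesCore_selfQuot_of_bijective _ _ _ (hbij PUnit.unit PUnit.unit)⟩

end EllipticModel

end Literature.AnabelianGeometry.AbsoluteAnabelian.AbsTopII

end
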